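import Literature.NumberTheory.Transcendental.KaehlerHodgeHarmonicCounterexample
import Literature.NumberTheory.Transcendental.ComplexDeRhamFinite
import Mathlib.Analysis.Calculus.MeanValue
import HarnessLib

/-!
# The named fact `sum_hodgeNumber_eq_finrank_complexDeRham` is false as stated (the rigged torus)

Theorems-only companion of `Literature/NumberTheory/Transcendental/KaehlerHodge.lean` (C12) and of
`KaehlerHodgeSumHodgeNumberFact.lean` (the corrected fact and its reduction to the Hodge
decomposition).

`KaehlerHodge.lean` records the numerical Hodge decomposition — C. Voisin, *Hodge Theory and
Complex Algebraic Geometry I* (2002), §6.1.3, p. 142 (`H^k(X, ℂ) = ⨁_{p+q=k} H^{p,q}` for a compact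
Kähler manifold `X`) with Rem. 8.29, pp. 204–205 (`b_k = ∑_{p+q=k} h^{p,q}`); D. Huybrechts,
*Complex Geometry* (2005), Cor. 3.2.12 — as the named fact
`Literature.NumberTheory.Transcendental.sum_hodgeNumber_eq_finrank_complexDeRham g`, a
`def … : Prop` written in `section Kaehler` after
`variable … [IsManifold 𝓘(ℂ, E) ω M] [IsManifold 𝓘(ℝ, E) ∞ M] (g …) (o …)`.

**Finding.** The body of the `def` mentions `g` (hence the real tangent bundle and
`[IsManifold 𝓘(ℝ, E) ∞ M]`), `hodgeNumber E M` and `complexDeRhamCohomology E M`, none of which uses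
the *complex*-manifold instance, so Lean did not abstract it:
`#check @sum_hodgeNumber_eq_finrank_complexDeRham` lists
`{E} [NormedAddCommGroup E] [NormedSpace ℂ E] {M} [TopologicalSpace M] [ChartedSpace E M]
[IsManifold 𝓘(ℝ, E) ∞ M] (g)` as its only binders — the defect already recorded for
`cHodgeLaplacian_eq_two_smul_dolbeaultLaplacian`, `isDolbeaultHarmonic_iff`,
`dolbeaultHarmonicForms_le_charmonicForms`, … (*Correction* notes in `KaehlerHodge.lean`). The fact is
therefore stated for every compact *real* `C^∞` manifold whose charts take values in a complex
normed space `E`, with the types `(p,q)` (`IsOfType`: weights of the rotations `e^{iθ}` of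
`TangentSpace 𝓘(ℝ, E) x = E`) and `∂̄` read in the coordinates of the *preferred chart* `chartAt x`,
which is not tensorial unless the transition maps are holomorphic, so that `hodgeNumber E M p q` is
a junk chart-wise Dolbeault dimension. This file proves that in that generality the fact is
**false** (`TorusConjAtlas.not_sum_hodgeNumber_eq_finrank_complexDeRham_torus`), records the
universal closure over exactly the binders the fact elaborates with
(`not_sum_hodgeNumber_eq_finrank_complexDeRham`; also the surface-level closure
`not_forall_sum_hodgeNumber_eq_finrank_complexDeRham`), and hence that **no closed proof
`sum_hodgeNumber_eq_finrank_complexDeRham_holds` can exist**. The intended statement carries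
`[IsManifold 𝓘(ℂ, E) ω M]` as a binder of the `def` itself: it is the corrected named fact
`sum_hodgeNumber_eq_finrank_complexDeRham_of_isManifold_complex` of
`KaehlerHodgeSumHodgeNumberFact.lean`, reduced there to the Hodge decomposition (hodge.S07).

## The counterexample (the `{id, conj}`-rigged torus of `KaehlerHodgeDolbeaultHarmonicCounterexample.lean`)

Everything about the manifold is reused from `namespace TorusConjAtlas`: `M = T² = (ℝ/ℤ)²`
(compact, Hausdorff), charted on `E = ℂ` by local inverses of the covering map `proj` followed by the
frame map `L_q ∈ {id, conj}` — `conj` exactly at the points with rational first coordinate, a dense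
and co-dense set —, a real-analytic atlas (`isManifoldT`) that is not holomorphic; the flat `C^∞`
metric `metric`, Kähler in the sense of `IsKaehler` (`isKaehler`, `KaehlerHodgeHarmonicCounterexample`).
Degree `k = 1`:

* **`h^{1,0} = h^{0,1} = 0`.** A `1`-form on `T_x T² = ℂ = ℝ1 ⊕ ℝi` is determined by its values on
  `1` and `i` (`apply_fin_one`); chart-type `(1,0)` means `α_x(i) = i α_x(1)`, chart-type `(0,1)`
  means `α_x(i) = -i α_x(1)` (rotation by `e^{iπ/2}`, `apply_I_of_isOfType_one_zero/zero_one`). The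
  chart representative of such an `α` at `x₀` takes at `y` the values `a(z)` on `1` and
  `ρ(Re y) ε(x₀) κ a(z)` on `i` (`z = proj (L_{x₀} y)`, `a = α(1)`, `κ = ±i`, `ρ = ±1` the
  nowhere-continuous rationality sign, `inChart_apply'`), both continuous in `y` near the centre when
  `α` is smooth; so `a(x₀) ≠ 0` would make `ρ` continuous (`eq_zero_of_isSmoothForm_of_apply_I`).
  Hence every smooth form of chart-type `(1,0)` or `(0,1)` is `0`, `Z^{1,0}_{∂̄} = Z^{0,1}_{∂̄} = 0`
  (`dolbeaultClosedForms_one_zero_eq_bot`, `…_zero_one_eq_bot`), the Dolbeault groups are trivial and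
  `∑_{p+q=1} h^{p,q} = 0` (`sum_hodgeNumber_one`).
* **`dim_ℂ H^1_dR(T²; ℂ) ≠ 0`.** The real direction is fixed by every frame, so `dx` has the constant
  representatives `Re` (`inChart_dx`): it is smooth and closed, and `dx ⊗ 1 ∈ Z^1(T²; ℂ)`
  (`dx_ofReal_mem_cclosedSmoothForms`, with the discharged `d(β ⊗ 1) = dβ ⊗ 1`). For a smooth
  function `β`, `dβ` evaluated on the chart vector `1` along the first circle is the honest derivative
  of `t ↦ β(proj t)` (`hasDerivAt_zero_form`: `mextDeriv_eq_extDerivWithin`, `extDeriv_constOfIsEmpty`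
  and the chain rule along `s ↦ s + (c - t)`), so every element of the `ℂ`-span `B^1(T²; ℂ)` of such
  `dβ` has a primitive `G` along the first circle with `G 1 = G 0`
  (`exists_periodic_primitive_of_mem_cexactSmoothForms`, span induction); `dx ⊗ 1` would need
  `G' = 1`, contradicting periodicity (`dx_ofReal_not_mem_cexactSmoothForms`,
  `is_const_of_deriv_eq_zero`). The class of `dx ⊗ 1` is thus nonzero, and `H^1_dR(T²; ℂ)` is
  finite-dimensional (`complexDeRhamCohomology.finite_of_compactSpace`, proved, Mayer–Vietoris), so
  its dimension is positive (`finrank_complexDeRhamCohomology_one_ne_zero`).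

Every identity used holds at every point; the only junk values are the ones the fact itself feeds
into `hodgeNumber` (it quantifies over this real-smooth, non-holomorphic atlas). No definition and
no named fact is introduced.

## References

* C. Voisin, *Hodge Theory and Complex Algebraic Geometry I*, Cambridge Studies in Advanced
  Mathematics 76 (2002), §6.1.3 (p. 142), Rem. 8.29 (pp. 204–205) — the intended (compact Kähler,
  in particular complex, manifold) statement. [cite: Voisin2002, §6.1.3 and Rem. 8.29]
* D. Huybrechts, *Complex Geometry. An Introduction*, Universitext (2005), Cor. 3.2.12.
  [cite: Huybrechts2005, Cor. 3.2.12]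
-/

noncomputable section

open scoped Manifold ContDiff Topology ComplexConjugate
open Bundle Module Set Filter Finset ContinuousAlternatingMap
open Literature.Geometry.Kaehler

namespace Literature.NumberTheory.Transcendental

namespace TorusConjAtlas

/-- `proj` is additive: `proj (z + w) = proj z + proj w`. [folklore] -/
theorem proj_add (z w : ℂ) : proj (z + w) = proj z + proj w := by
  simp only [proj, Complex.add_re, Complex.add_im, AddCircle.coe_add, Prod.mk_add_mk]

/-- `proj 1 = proj 0`: the first circle closes up after one period. [folklore] -/
theorem proj_one_eq_proj_zero : proj ((1 : ℝ) : ℂ) = proj ((0 : ℝ) : ℂ) := by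
  refine Prod.ext ?_ ?_
  · simp only [proj, Complex.ofReal_one, Complex.one_re, Complex.ofReal_zero, Complex.zero_re,
      AddCircle.coe_period, AddCircle.coe_zero]
  · simp [proj]

/-- The frame map fixes the real axis: `L_q r = r` for real `r`. [folklore] -/
theorem L_ofReal (q : T) (r : ℝ) : L q (r : ℂ) = r := by
  apply Complex.ext
  · rw [re_L]
  · rw [im_L, Complex.ofReal_im, mul_zero]

/-- `e^{iπ/2} = i`. [folklore] -/
theorem exp_pi_div_two_mul_I : Complex.exp (((Real.pi / 2 : ℝ) : ℂ) * Complex.I) = Complex.I := by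
  apply Complex.ext
  · rw [Complex.exp_ofReal_mul_I_re, Real.cos_pi_div_two, Complex.I_re]
  · rw [Complex.exp_ofReal_mul_I_im, Real.sin_pi_div_two, Complex.I_im]

section Charts

attribute [local instance] chartedSpaceT isManifoldT

/-- **A `1`-form on `T_x T² = ℂ = ℝ1 ⊕ ℝi` is determined by its values on `1` and `i`**:
`φ(v) = Re v · φ(1) + Im v · φ(i)` (real linearity in the single slot). [folklore] -/
theorem apply_fin_one (x : T) (φ : TangentSpace 𝓘(ℝ, ℂ) x [⋀^Fin 1]→L[ℝ] ℂ)
    (v : Fin 1 → TangentSpace 𝓘(ℝ, ℂ) x) :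
    φ v = (Complex.re (v 0) : ℂ) * φ (fun _ ↦ (1 : ℂ)) +
      (Complex.im (v 0) : ℂ) * φ (fun _ ↦ (Complex.I : ℂ)) := by
  set ℓ : TangentSpace 𝓘(ℝ, ℂ) x →L[ℝ] ℂ :=
    (ContinuousAlternatingMap.ofSubsingleton ℝ (TangentSpace 𝓘(ℝ, ℂ) x) ℂ (0 : Fin 1)).symm φ
    with hℓ
  have hφ : φ = ContinuousAlternatingMap.ofSubsingleton ℝ (TangentSpace 𝓘(ℝ, ℂ) x) ℂ (0 : Fin 1) ℓ :=
    (Equiv.apply_symm_apply _ _).symm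
  have hv : (v 0 : TangentSpace 𝓘(ℝ, ℂ) x) =
      (Complex.re (v 0) : ℝ) • (show TangentSpace 𝓘(ℝ, ℂ) x from (1 : ℂ)) +
        (Complex.im (v 0) : ℝ) • (show TangentSpace 𝓘(ℝ, ℂ) x from (Complex.I : ℂ)) := by
    change (v 0 : ℂ) = ((Complex.re (v 0) : ℝ) • (1 : ℂ) + (Complex.im (v 0) : ℝ) • Complex.I : ℂ)
    rw [Complex.real_smul, Complex.real_smul, mul_one]
    exact (Complex.re_add_im _).symm
  rw [hφ]
  simp only [ContinuousAlternatingMap.ofSubsingleton_apply_apply]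
  conv_lhs => rw [hv]
  rw [map_add, map_smul, map_smul, Complex.real_smul, Complex.real_smul]

/-! ### Smooth `1`-forms of chart-type `(1,0)` or `(0,1)` vanish identically -/

/-- **Key lemma.** On the rigged torus a *smooth* complex `1`-form `α` whose value on the chart
vector `i` is a fixed nonzero multiple `κ` of its value on the chart vector `1` at every point
(as it is for forms of chart-type `(1,0)`, `κ = i`, and `(0,1)`, `κ = -i`) vanishes identically:
in the chart at `x₀` the representative of `α` takes, at `y`, the value `a(z)` on `1` and
`ε(z) ε(x₀) κ a(z)` on `i` (`z = proj (L_{x₀} y)`, `a(z) = α_z(1)`, `ε(z) = ρ(Re y)`); both are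
continuous in `y` near the centre, so if `a(x₀) ≠ 0` the nowhere-continuous `ρ` would be continuous
at `Re` of the centre. [folklore] -/
theorem eq_zero_of_isSmoothForm_of_apply_I {α : MForm 𝓘(ℝ, ℂ) T ℂ 1} (hα : IsSmoothForm α)
    {κ : ℂ} (hκ : κ ≠ 0)
    (h : ∀ x : T, α x (fun _ ↦ (Complex.I : ℂ)) = κ * α x (fun _ ↦ (1 : ℂ))) : α = 0 := by
  -- the coefficient `a(x) = α_x(1)` vanishes everywhere
  have ha : ∀ x₀ : T, α x₀ (fun _ ↦ (1 : ℂ)) = 0 := by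
    intro x₀
    by_contra hne
    set c : ℂ := extChartAt 𝓘(ℝ, ℂ) x₀ x₀ with hc
    have hcont : ContinuousAt (α.inChart x₀) c := by
      have h1 := hα x₀
      rw [ModelWithCorners.Boundaryless.range_eq_univ, contDiffWithinAt_univ] at h1
      exact h1.continuousAt
    -- values of the representative on `1` and on `i`
    have hA : ∀ y, α.inChart x₀ y (fun _ ↦ (1 : ℂ)) = α (proj (L x₀ y)) (fun _ ↦ (1 : ℂ)) := by
      intro y
      rw [inChart_apply', apply_fin_one]
      simp only [re_τT, im_τT, Complex.one_re, Complex.one_im, Complex.ofReal_one, one_mul,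
        mul_zero, Complex.ofReal_zero, zero_mul, add_zero]
    have hB : ∀ y, α.inChart x₀ y (fun _ ↦ (Complex.I : ℂ)) =
        ((ρ y.re * sgn x₀ : ℝ) : ℂ) * (κ * α (proj (L x₀ y)) (fun _ ↦ (1 : ℂ))) := by
      intro y
      rw [inChart_apply', apply_fin_one]
      simp only [re_τT, im_τT, Complex.I_re, Complex.I_im, Complex.ofReal_zero, zero_mul,
        zero_add, mul_one, h, sgn_proj, re_L]
    have hcA : ContinuousAt (fun y ↦ α (proj (L x₀ y)) (fun _ ↦ (1 : ℂ))) c := by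
      have := ((ContinuousAlternatingMap.apply ℝ ℂ ℂ
        (fun _ : Fin 1 ↦ (1 : ℂ))).continuous.continuousAt).comp hcont
      simpa only [Function.comp_def, ContinuousAlternatingMap.apply_apply, hA] using this
    have hcB : ContinuousAt (fun y ↦ ((ρ y.re * sgn x₀ : ℝ) : ℂ) *
        (κ * α (proj (L x₀ y)) (fun _ ↦ (1 : ℂ)))) c := by
      have := ((ContinuousAlternatingMap.apply ℝ ℂ ℂ
        (fun _ : Fin 1 ↦ (Complex.I : ℂ))).continuous.continuousAt).comp hcont
      simpa only [Function.comp_def, ContinuousAlternatingMap.apply_apply, hB] using this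
    -- the centre of the chart maps to `x₀`, where `a ≠ 0`
    have hc0 : proj (L x₀ c) = x₀ := proj_lift x₀
    have hg : ContinuousAt (fun y ↦ κ * α (proj (L x₀ y)) (fun _ ↦ (1 : ℂ))) c :=
      continuousAt_const.mul hcA
    have hne' : κ * α (proj (L x₀ c)) (fun _ ↦ (1 : ℂ)) ≠ 0 := by
      rw [hc0]; exact mul_ne_zero hκ hne
    -- hence `y ↦ ρ(Re y) ε(x₀)` is continuous at `c`
    have hq : ContinuousAt (fun y ↦ ((ρ y.re * sgn x₀ : ℝ) : ℂ)) c := by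
      refine (hcB.div hg hne').congr ?_
      filter_upwards [hg.eventually_ne hne'] with y hy
      rw [Pi.div_apply, mul_div_assoc, div_self hy, mul_one]
    have hρ : ContinuousAt (fun y : ℂ ↦ ρ y.re) c := by
      have h1 : ContinuousAt (fun y ↦ ρ y.re * sgn x₀) c := by
        have := Complex.continuous_re.continuousAt.comp hq
        simpa only [Function.comp_def, Complex.ofReal_re] using this
      have h2 : ContinuousAt (fun y ↦ ρ y.re * sgn x₀ * sgn x₀) c := h1.mul continuousAt_const
      exact h2.congr (Eventually.of_forall fun y ↦ by
        show ρ y.re * sgn x₀ * sgn x₀ = ρ y.re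
        rw [mul_assoc, sgn_mul_sgn, mul_one])
    -- restrict to the horizontal line through `c`
    have hline : Continuous fun t : ℝ ↦ ((t : ℝ) : ℂ) + ((c.im : ℝ) : ℂ) * Complex.I := by fun_prop
    have hc' : ((c.re : ℝ) : ℂ) + ((c.im : ℝ) : ℂ) * Complex.I = c := Complex.re_add_im c
    have h3 : ContinuousAt ρ c.re := by
      have := hρ.comp_of_eq hline.continuousAt hc'
      simpa [Function.comp_def] using this
    exact not_continuousAt_ρ c.re h3
  -- a `1`-form on `ℂ = ℝ1 ⊕ ℝi` vanishing on `1` and on `i` is zero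
  funext x
  ext v
  rw [apply_fin_one, h, ha, mul_zero, mul_zero, mul_zero, add_zero]
  rfl

/-- On a form of chart-type `(1,0)` the value on `i` is `i` times the value on `1`
(rotation by `e^{iπ/2}`). [folklore] -/
theorem apply_I_of_isOfType_one_zero {α : MForm 𝓘(ℝ, ℂ) T ℂ 1} (ht : IsOfType 1 0 α) (x : T) :
    α x (fun _ ↦ (Complex.I : ℂ)) = Complex.I * α x (fun _ ↦ (1 : ℂ)) := by
  have h1 := ht.2 x (Real.pi / 2) (fun _ ↦ (1 : ℂ))
  rw [apply_fin_one] at h1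
  simp only [tangentRotate_apply, smul_eq_mul, mul_one, exp_pi_div_two_mul_I, Complex.I_re,
    Complex.I_im, Complex.ofReal_zero, zero_mul, zero_add, Complex.ofReal_one, one_mul,
    Nat.cast_one, Nat.cast_zero, sub_zero, Int.cast_one] at h1
  exact h1

/-- On a form of chart-type `(0,1)` the value on `i` is `-i` times the value on `1`
(rotation by `e^{iπ/2}` acts by `e^{-iπ/2}`). [folklore] -/
theorem apply_I_of_isOfType_zero_one {α : MForm 𝓘(ℝ, ℂ) T ℂ 1} (ht : IsOfType 0 1 α) (x : T) :
    α x (fun _ ↦ (Complex.I : ℂ)) = -Complex.I * α x (fun _ ↦ (1 : ℂ)) := by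
  have h1 := ht.2 x (Real.pi / 2) (fun _ ↦ (1 : ℂ))
  rw [apply_fin_one] at h1
  have he : Complex.exp ((((0 : ℕ) : ℤ) - (1 : ℕ) : ℤ) * ((Real.pi / 2 : ℝ) : ℂ) * Complex.I) =
      -Complex.I := by
    rw [show ((((0 : ℕ) : ℤ) - (1 : ℕ) : ℤ) : ℂ) * ((Real.pi / 2 : ℝ) : ℂ) * Complex.I =
        -(((Real.pi / 2 : ℝ) : ℂ) * Complex.I) by push_cast; ring, Complex.exp_neg,
      exp_pi_div_two_mul_I, Complex.inv_I]
  simp only [tangentRotate_apply, smul_eq_mul, mul_one, exp_pi_div_two_mul_I, Complex.I_re,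
    Complex.I_im, Complex.ofReal_zero, zero_mul, zero_add, Complex.ofReal_one, one_mul, he] at h1
  exact h1

/-- **Every smooth `1`-form of chart-type `(1,0)` on the rigged torus is `0`.** [folklore] -/
theorem eq_zero_of_isOfType_one_zero {α : MForm 𝓘(ℝ, ℂ) T ℂ 1} (hα : IsSmoothForm α)
    (ht : IsOfType 1 0 α) : α = 0 :=
  eq_zero_of_isSmoothForm_of_apply_I hα Complex.I_ne_zero (apply_I_of_isOfType_one_zero ht)

/-- **Every smooth `1`-form of chart-type `(0,1)` on the rigged torus is `0`.** [folklore] -/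
theorem eq_zero_of_isOfType_zero_one {α : MForm 𝓘(ℝ, ℂ) T ℂ 1} (hα : IsSmoothForm α)
    (ht : IsOfType 0 1 α) : α = 0 :=
  eq_zero_of_isSmoothForm_of_apply_I hα (neg_ne_zero.2 Complex.I_ne_zero)
    (apply_I_of_isOfType_zero_one ht)

/-! ### Hence `h^{1,0} = h^{0,1} = 0` -/

/-- `Z^{1,0}_{∂̄} = 0` on the rigged torus. [folklore] -/
theorem dolbeaultClosedForms_one_zero_eq_bot : dolbeaultClosedForms ℂ T 1 0 = ⊥ :=
  Submodule.span_eq_bot.2 fun _ hα ↦ eq_zero_of_isOfType_one_zero hα.1 hα.2.1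

/-- `Z^{0,1}_{∂̄} = 0` on the rigged torus. [folklore] -/
theorem dolbeaultClosedForms_zero_one_eq_bot : dolbeaultClosedForms ℂ T 0 1 = ⊥ :=
  Submodule.span_eq_bot.2 fun _ hα ↦ eq_zero_of_isOfType_zero_one hα.1 hα.2.1

/-- A Dolbeault group with trivial closed forms is trivial, so its Hodge number is `0`.
[folklore] -/
theorem hodgeNumber_eq_zero_of_eq_bot {p q : ℕ} (h : dolbeaultClosedForms ℂ T p q = ⊥) :
    hodgeNumber ℂ T p q = 0 := by
  haveI : Subsingleton (dolbeaultCohomology ℂ T p q) := by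
    refine subsingleton_of_forall_eq 0 fun c ↦ ?_
    obtain ⟨a, rfl⟩ := dolbeaultCohomology.mk_surjective c
    have ha : a = 0 := Subtype.ext ((Submodule.eq_bot_iff _).1 h a a.2)
    rw [ha, _root_.map_zero]
  exact Module.finrank_zero_of_subsingleton

/-- **`h^{1,0} = 0`** on the rigged torus. [folklore] -/
theorem hodgeNumber_one_zero : hodgeNumber ℂ T 1 0 = 0 :=
  hodgeNumber_eq_zero_of_eq_bot dolbeaultClosedForms_one_zero_eq_bot

/-- **`h^{0,1} = 0`** on the rigged torus. [folklore] -/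
theorem hodgeNumber_zero_one : hodgeNumber ℂ T 0 1 = 0 :=
  hodgeNumber_eq_zero_of_eq_bot dolbeaultClosedForms_zero_one_eq_bot

/-- **`∑_{p+q=1} h^{p,q} = 0`** on the rigged torus. [folklore] -/
theorem sum_hodgeNumber_one : ∑ pq ∈ antidiagonal 1, hodgeNumber ℂ T pq.1 pq.2 = 0 := by
  rw [Finset.Nat.sum_antidiagonal_eq_sum_range_succ_mk, Finset.sum_range_succ,
    Finset.sum_range_succ, Finset.sum_range_zero, zero_add]
  simp [hodgeNumber_one_zero, hodgeNumber_zero_one]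

/-! ### `dx ⊗ 1` is a smooth closed complex `1`-form -/

/-- The chart representatives of `dx` are the constant `Re` (the frames fix the real axis).
[folklore] -/
theorem inChart_dx (x₀ : T) (y : ℂ) :
    dx.inChart x₀ y = ContinuousAlternatingMap.ofSubsingleton ℝ ℂ ℝ (0 : Fin 1) Complex.reCLM := by
  ext v
  rw [inChart_apply', dx_apply, ContinuousAlternatingMap.ofSubsingleton_apply_apply,
    Complex.reCLM_apply, re_τT]

/-- `dx` is smooth on the rigged torus. [folklore] -/
theorem isSmoothForm_dx : IsSmoothForm dx := by
  intro x
  rw [funext (inChart_dx x)]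
  exact contDiffWithinAt_const

/-- `dx` is closed on the rigged torus (constant representatives). [folklore] -/
theorem mextDeriv_dx : mextDeriv dx = 0 := by
  funext x
  exact mextDeriv_apply_eq_zero (by
    rw [funext (inChart_dx x), ModelWithCorners.Boundaryless.range_eq_univ, fderivWithin_univ]
    exact fderiv_const_apply _)

/-- **`dx ⊗ 1` is a smooth closed complex `1`-form**, i.e. lies in `Z^1(T²; ℂ)`. [folklore] -/
theorem dx_ofReal_mem_cclosedSmoothForms : dx.ofReal ∈ cclosedSmoothForms ℂ T 1 :=
  mem_cclosedSmoothForms isSmoothForm_dx.ofReal (by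
    rw [IsClosedForm, MForm.mextDeriv_ofReal_holds dx, mextDeriv_dx, MForm.ofReal_zero])

/-- `(dx ⊗ 1)(1) = 1` at every point. [folklore] -/
theorem dx_ofReal_apply_one (x : T) : dx.ofReal x (fun _ ↦ (1 : ℂ)) = 1 := by
  rw [MForm.ofReal_apply, dx_apply, Complex.one_re, Complex.ofReal_one]

/-! ### Exact `1`-forms have periodic primitives along the first circle; `dx ⊗ 1` has period `1` -/

/-- The chart representatives of a complex `0`-form `β` (a function): `y ↦ β(proj (L_{x₀} y))`.
[folklore] -/
theorem inChart_zero_form (β : MForm 𝓘(ℝ, ℂ) T ℂ 0) (x₀ : T) (y : ℂ) :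
    β.inChart x₀ y = constOfIsEmpty ℝ ℂ (Fin 0) (β (proj (L x₀ y)) fun i ↦ i.elim0) := by
  ext v
  rw [inChart_apply', constOfIsEmpty_apply]
  exact congrArg (β (proj (L x₀ y))) (funext fun i ↦ i.elim0)

/-- **`d` of a `0`-form is an honest derivative**: `(dβ)_q(v) = D(β ∘ proj ∘ L_q)(c_q) v`, the
Fréchet derivative of the chart expression at the chart centre `c_q`. [folklore] -/
theorem mextDeriv_zero_form_apply (β : MForm 𝓘(ℝ, ℂ) T ℂ 0) (q : T)
    (v : Fin 1 → TangentSpace 𝓘(ℝ, ℂ) q) :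
    mextDeriv β q v = fderiv ℝ (fun y ↦ β (proj (L q y)) fun i ↦ i.elim0)
      (extChartAt 𝓘(ℝ, ℂ) q q) (v 0) := by
  rw [mextDeriv_eq_extDerivWithin, funext (inChart_zero_form β q),
    ModelWithCorners.Boundaryless.range_eq_univ, extDerivWithin_univ, extDeriv_constOfIsEmpty]
  rfl

/-- **Along the first circle, `dβ` evaluated on `1` is the derivative of `t ↦ β(proj t)`** for a
smooth `0`-form `β` (the frames fix the real direction, so the rigging is invisible). [folklore] -/
theorem hasDerivAt_zero_form {β : MForm 𝓘(ℝ, ℂ) T ℂ 0} (hβ : IsSmoothForm β) (t : ℝ) :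
    HasDerivAt (fun s : ℝ ↦ β (proj (s : ℂ)) fun i ↦ i.elim0)
      (mextDeriv β (proj (t : ℂ)) fun _ ↦ (1 : ℂ)) t := by
  set q : T := proj (t : ℂ) with hq
  set c : ℂ := extChartAt 𝓘(ℝ, ℂ) q q with hc
  set φ : ℂ → ℂ := fun y ↦ β (proj (L q y)) fun i ↦ i.elim0 with hφ
  -- `φ` is differentiable at the centre (smoothness of `β`)
  have hd : DifferentiableAt ℝ φ c := by
    have h1 := hβ q
    rw [ModelWithCorners.Boundaryless.range_eq_univ, contDiffWithinAt_univ] at h1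
    have h2 : DifferentiableAt ℝ (β.inChart q) c := h1.differentiableAt (by simp)
    have h3 := ((ContinuousAlternatingMap.apply ℝ ℂ ℂ (fun i : Fin 0 ↦ i.elim0)).differentiableAt).comp c h2
    refine h3.congr_of_eventuallyEq (Eventually.of_forall fun y ↦ ?_)
    simp only [hφ, Function.comp_apply, ContinuousAlternatingMap.apply_apply, inChart_zero_form,
      constOfIsEmpty_apply]
  -- the horizontal line through the centre parametrises the first circle through `q`
  have hline : HasDerivAt (fun s : ℝ ↦ (s : ℂ) + (c - t)) 1 t := by
    simpa using ((hasDerivAt_id t).ofReal_comp).add_const (c - (t : ℂ))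
  have hcomp : HasDerivAt (φ ∘ fun s : ℝ ↦ (s : ℂ) + (c - t)) (fderiv ℝ φ c 1) t :=
    hd.hasFDerivAt.comp_hasDerivAt_of_eq t hline (by simp)
  have heq : (φ ∘ fun s : ℝ ↦ (s : ℂ) + (c - t)) = fun s : ℝ ↦ β (proj (s : ℂ)) fun i ↦ i.elim0 := by
    funext s
    have hpt : proj (L q ((s : ℂ) + (c - t))) = proj (s : ℂ) := by
      rw [map_add, map_sub, L_ofReal, L_ofReal, proj_add, proj_sub]
      change proj (s : ℂ) + (proj (lift q) - q) = proj (s : ℂ)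
      rw [proj_lift, sub_self, add_zero]
    simp only [hφ, Function.comp_apply]
    rw [hpt]
  rw [heq] at hcomp
  rwa [mextDeriv_zero_form_apply]

/-- **Exact smooth complex `1`-forms have `1`-periodic primitives along the first circle**: every
`γ ∈ B^1(T²; ℂ)` (the `ℂ`-span of `dβ`, `β` a smooth function) admits `G : ℝ → ℂ` with
`G' (t) = γ_{proj t}(1)` and `G 1 = G 0` (for a generator, `G = β ∘ proj`; the property is
`ℂ`-linear). [folklore] -/
theorem exists_periodic_primitive_of_mem_cexactSmoothForms {γ : MForm 𝓘(ℝ, ℂ) T ℂ 1}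
    (hγ : γ ∈ cexactSmoothForms ℂ T 1) :
    ∃ G : ℝ → ℂ, (∀ t : ℝ, HasDerivAt G (γ (proj (t : ℂ)) fun _ ↦ (1 : ℂ)) t) ∧ G 1 = G 0 := by
  change γ ∈ Submodule.span ℂ _ at hγ
  induction hγ using Submodule.span_induction with
  | mem γ hγ =>
    obtain ⟨β, hβ, rfl⟩ := hγ
    have hβ' : IsSmoothForm β := (mem_csmoothForms_iff β).1 hβ
    refine ⟨fun s ↦ β (proj (s : ℂ)) fun i ↦ i.elim0, hasDerivAt_zero_form hβ', ?_⟩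
    beta_reduce
    rw [proj_one_eq_proj_zero]
  | zero => exact ⟨fun _ ↦ 0, fun t ↦ (hasDerivAt_const t (0 : ℂ)).congr_deriv rfl, rfl⟩
  | add γ₁ γ₂ _ _ h₁ h₂ =>
    obtain ⟨G₁, hG₁, e₁⟩ := h₁
    obtain ⟨G₂, hG₂, e₂⟩ := h₂
    refine ⟨fun s ↦ G₁ s + G₂ s, fun t ↦ (hG₁ t).add (hG₂ t), ?_⟩
    simp only [e₁, e₂]
  | smul a γ _ h₁ =>
    obtain ⟨G, hG, e⟩ := h₁
    refine ⟨fun s ↦ a * G s, fun t ↦ ?_, by simp only [e]⟩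
    simpa only [Pi.smul_apply, ContinuousAlternatingMap.smul_apply, smul_eq_mul] using
      (hG t).const_mul a

/-- **`dx ⊗ 1` is not exact**: a primitive along the first circle would satisfy `G' = 1` and
`G 1 = G 0`. [folklore] -/
theorem dx_ofReal_not_mem_cexactSmoothForms : dx.ofReal ∉ cexactSmoothForms ℂ T 1 := by
  intro hmem
  obtain ⟨G, hG, hper⟩ := exists_periodic_primitive_of_mem_cexactSmoothForms hmem
  simp only [dx_ofReal_apply_one] at hG
  have hH : ∀ t, HasDerivAt (fun s : ℝ ↦ G s - (s : ℂ)) 0 t := fun t ↦ by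
    have h1 := (hG t).sub (hasDerivAt_id t).ofReal_comp
    rw [Complex.ofReal_one, sub_self] at h1
    exact h1
  have hconst := is_const_of_deriv_eq_zero (fun t ↦ (hH t).differentiableAt)
    (fun t ↦ (hH t).deriv) 1 0
  simp only [Complex.ofReal_one, Complex.ofReal_zero, sub_zero, hper] at hconst
  exact one_ne_zero (sub_eq_self.1 hconst)

/-- **`H^1_dR(T²; ℂ) ≠ 0`** for the rigged torus: the class of `dx ⊗ 1` is nonzero, and the complex
de Rham cohomology of the compact manifold `T²` is finite-dimensional
(`complexDeRhamCohomology.finite_of_compactSpace`), so its dimension is positive. [folklore] -/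
theorem finrank_complexDeRhamCohomology_one_ne_zero :
    finrank ℂ (complexDeRhamCohomology ℂ T 1) ≠ 0 := by
  haveI := complexDeRhamCohomology.finite_of_compactSpace ℂ T 1
  have hne : complexDeRhamCohomology.mk ℂ T 1 ⟨dx.ofReal, dx_ofReal_mem_cclosedSmoothForms⟩ ≠ 0 := by
    intro h0
    rw [← (complexDeRhamCohomology.mk ℂ T 1).map_zero, complexDeRhamCohomology.mk_eq_mk_iff,
      ZeroMemClass.coe_zero, sub_zero] at h0
    exact dx_ofReal_not_mem_cexactSmoothForms h0
  haveI : Nontrivial (complexDeRhamCohomology ℂ T 1) := nontrivial_of_ne _ _ hne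
  exact Module.finrank_pos.ne'

/-! ### Assembly -/

/-- **The named fact `sum_hodgeNumber_eq_finrank_complexDeRham` is false for the rigged torus**
(`E = ℂ`, the flat `C^∞` metric `metric`, which is Kähler in the sense of `IsKaehler`, degree
`k = 1`): `h^{1,0} + h^{0,1} = 0` while `dim_ℂ H^1_dR(T²; ℂ) ≠ 0`. [folklore] -/
theorem not_sum_hodgeNumber_eq_finrank_complexDeRham_torus :
    ¬ sum_hodgeNumber_eq_finrank_complexDeRham metric := by
  intro H
  have key := H isKaehler 1
  rw [sum_hodgeNumber_one] at key
  exact finrank_complexDeRhamCohomology_one_ne_zero key.symm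

end Charts

end TorusConjAtlas

section UniversalClosure

attribute [local instance] TorusConjAtlas.chartedSpaceT TorusConjAtlas.isManifoldT

/-- **`sum_hodgeNumber_eq_finrank_complexDeRham` fails already over real `C^∞` surfaces charted in
`ℂ`** (smooth metric): witness the rigged torus `TorusConjAtlas.T` with the flat metric
(`TorusConjAtlas.not_sum_hodgeNumber_eq_finrank_complexDeRham_torus`). The intended statement is
Voisin (2002), §6.1.3 / Rem. 8.29 and Huybrechts (2005), Cor. 3.2.12, for compact Kähler — in
particular complex — manifolds. [folklore] -/
theorem not_forall_sum_hodgeNumber_eq_finrank_complexDeRham :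
    ¬ ∀ (M : Type) [TopologicalSpace M] [ChartedSpace ℂ M] [IsManifold 𝓘(ℝ, ℂ) ∞ M]
        (g : ContMDiffRiemannianMetric 𝓘(ℝ, ℂ) ∞ ℂ (fun x : M ↦ TangentSpace 𝓘(ℝ, ℂ) x)),
        sum_hodgeNumber_eq_finrank_complexDeRham g :=
  fun H ↦ TorusConjAtlas.not_sum_hodgeNumber_eq_finrank_complexDeRham_torus
    (H TorusConjAtlas.T TorusConjAtlas.metric)

/-- **The named fact `sum_hodgeNumber_eq_finrank_complexDeRham` is false as stated.** Closed
universally over exactly the binders it elaborates with — a complex normed space `E`, a charted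
space `M` over `E` that is a *real* `C^∞` manifold (no `[IsManifold 𝓘(ℂ, E) ω M]`: the section
instance is not mentioned in the body of the `def` and was therefore not abstracted) and a `C^∞`
Riemannian metric `g` — the statement fails: witness `E = ℂ`, the compact Hausdorff torus `(ℝ/ℤ)²`
with the `{id, conj}`-rigged real-analytic atlas `TorusConjAtlas.chartedSpaceT` and the flat
(Kähler) metric, in degree `k = 1` (`TorusConjAtlas.not_sum_hodgeNumber_eq_finrank_complexDeRham_torus`).
Hence no closed proof `sum_hodgeNumber_eq_finrank_complexDeRham_holds` can exist. The intended
statement — Voisin (2002), §6.1.3 (p. 142) with Rem. 8.29 (pp. 204–205); Huybrechts (2005),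
Cor. 3.2.12 — carries the complex-manifold hypothesis; it is the corrected named fact
`sum_hodgeNumber_eq_finrank_complexDeRham_of_isManifold_complex`
(`KaehlerHodgeSumHodgeNumberFact.lean`), reduced there to the Hodge decomposition (hodge.S07).
[folklore] -/
theorem not_sum_hodgeNumber_eq_finrank_complexDeRham :
    ¬ ∀ {E : Type} [NormedAddCommGroup E] [NormedSpace ℂ E] {M : Type} [TopologicalSpace M]
        [ChartedSpace E M] [IsManifold 𝓘(ℝ, E) ∞ M]
        (g : ContMDiffRiemannianMetric 𝓘(ℝ, E) ∞ E (fun x : M ↦ TangentSpace 𝓘(ℝ, E) x)),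
        sum_hodgeNumber_eq_finrank_complexDeRham g :=
  fun H ↦ not_forall_sum_hodgeNumber_eq_finrank_complexDeRham fun M _ _ _ g ↦ @H ℂ _ _ M _ _ _ g

end UniversalClosure

end Literature.NumberTheory.Transcendental
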